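import Summits.QuantumFields.BalabanUV.Beta.D1BFx.ProjectorMasses
import Summits.QuantumFields.BalabanUV.Beta.D1BFx.CoframeJetProjection
import Summits.QuantumFields.BalabanUV.Beta.D1BFx.StencilRealisation

/-!
# `BalabanUV.Beta.D1BFx.CompositeLegMasses` — road «BF-x» for binder row D1, slot (K), (II)-rows (C1)(C2), FILE γ3 «LEG-MASS ∕ COMPOSITE»: **THE MASSES OF
# `Cgh = n⁴·Ggh∘Rgt∘Ggh` (`n⁴`), `lapU∘Cgh` AND `Cgh∘lapU` (`n²`), AND THE MASTER LETTER `exists_leg_masses`** — all the road's legs, n-FREE constants,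
# θ-weighted, on the scales `n = L^k`, from lit-balaban's profile of `G_k(0)` (β1∕β2) through α1∕α2∕γ1∕γ2

HONEST DEPENDENCY (cell records, verbatim): «continuum YM on T⁴ ⇐ BetaPertH ∧ nine spine estimates (0/9 proved); BetaPertH ⇐ (D1) ∧ (D4) ∧
CAP+tail; G-an2-4 gates asym, D1 and NE2/3/4.»  HONEST FRAMING (cell contract, verbatim): «discharging `BetaPertH` makes Bałaban's UV stability
UNCONDITIONAL — a real constructive-QFT result; it is NOT the continuum limit and NOT the Clay problem.»  THIS MODULE DISCHARGES NOTHING of the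
wall: [folklore] bookkeeping BY NAME (`KGhostLeg.Cgh_apply`, `TameKernelCalculus.comp_assoc_tame`, `RJetProjector.Rgt_symm`, `TorusGhostWordArrays.decays_lapU`,
FILES α1 γ1 γ2, β2 `exists_Ggh_masses`); generic helpers `tame_of_masses`, `Zl_antitone` (`comp_smul_left∕right` reused from `StencilRealisation`, `Cgh_eq_smul ∕ trK_Rgt` from leaf-03's `CoframeJetProjection`).  No definition, no `def … : Prop`,
nothing cited, 0 sorry.  0 root-level binders of row D1 discharged (hW ∕ hR-sockets ∕ hSX-socket ∕ D1Tel ∕ D1Rep = 0); (K) NOT closed; (C1)(C2) NOT closed here (these are their LEG letters); NOT D1, NOT `BetaPertH`, NOT continuum, NOT Clay.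

ABSOLUTE RULE (cell charter, verbatim): «No internally-minted statement may enter as a cited fact. Every hypothesis is either kernel-proved in
this package or a verbatim quotation of a PUBLISHED theorem with page reference. The manuscript(s) under audit are NOT citable for their own
disputed steps — they are the thing under adjudication; programme-internal (2001/route/tribunal) claims are never citable.»

WHY.  W-1 l.43312 (F2): with these letters every P4b word of (C2) counts `n⁰` in the mass currency (FILE δ), and (C1)'s combined jet with the
gradient twins (γ′).  The powers displayed are the TRUE ones: `Ggh n⁰`, `lapU∘Ggh n⁻²`, `Pgt n⁰`, `Rgt n⁰`, `Cgh n⁴`, `lapU∘Cgh, Cgh∘lapU n²`.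

CONTENT.
* §1 `tame_of_masses` (`RowMass K 0 M → ColMass K 0 M′ → Tame K`), `Zl_antitone`.
* §2 `tame_lapU`, **`masses_Cgh`** (`n⁴·(g·(r·g))`), **`lapU_comp_Cgh`** (`comp lapU Cgh = n⁴ • (lapU∘Ggh)∘(Rgt∘Ggh)`),
  `trK_lapU_comp_Cgh` (`= comp Cgh lapU`), **`masses_lapU_Cgh`** (both orders: `n⁴·((n²)⁻¹(1 + a e^{4nθ} g))·(r·g)`), `masses_Ggh_lapU` (transpose),
  `lapU_comp_Cgh_comp_lapU` (`= n⁴ • (lapU∘Ggh)∘(Rgt∘(Ggh∘lapU))`), **`masses_lapU_Cgh_lapU`** (`n⁴·ℓ·(r·ℓ)`, `ℓ = (n²)⁻¹(1 + a e^{4nθ} g)`: the `n⁰` leg).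
* §3 **`exists_leg_masses (hL : 2 ≤ L) (ha : 0 < a) : ∃ θ₀ g π, 0 < θ₀ ∧ 0 ≤ g ∧ 0 ≤ π ∧ ∀ k ≥ 1, ∀ n [NeZero n], n = L^k → ∀ θ, 0 ≤ θ → θ ≤ θ₀∕n →`**
  the eight pairs of `RowMass∕ColMass` letters (`θ₀ = min (δ∕8) (δ_C∕8)`, `π = e^{8θ₀}·g²·c_C·Zl 4 (δ_C∕8)`).
NOT HERE: the gradient masses for (C1) (γ′), the vertices and the sixteen words (δ).
Unit `b2b-balaban-gan24-formalise-leaf-05` (gen 54), G-an2-4 swarm leaf prover 05, road «BF-x» (C1)(C2) count owner (RULING ρ-g19-1 AMENDED, journal l.43347); INTENT «LEG-MASS» (journal).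
-/


noncomputable section

namespace Summit.QuantumFields.BalabanUV.Beta.D1BFx.CompositeLegMasses

open scoped BigOperators
open Finset
open Literature.MathematicalPhysics.QuantumFieldTheory.Balaban1983to89
open Literature.MathematicalPhysics.QuantumFieldTheory.Balaban1983to89.Beta
open B12Sec2to5 (l1 l1_nonneg summable_exp_neg_l1)
open ExpKernelCalculus (Site MKer comp Zl Zl_pos Decays)
open HessKerSchurResolvent (idK)
open B6QGQLower276 (e lapKer lapKer_symm)
open B6QGGQ278Zd (cC deltaC deltaC_pos cC_pos)
open Summit.QuantumFields.BalabanUV.Beta.TameKernelCalculus (trK trK_comp trK_trK Tame Spr RowMaj ColMaj comp_assoc_tame Spr.tame)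
open KernelWard (Bdd)
open Summit.QuantumFields.BalabanUV.Beta.D1BFx.GhostLeg (Ggh Ggh_symm trK_Ggh tame_Ggh)
open Summit.QuantumFields.BalabanUV.Beta.D1BFx.RProjector (Pgt Pgt_symm)
open Summit.QuantumFields.BalabanUV.Beta.D1BFx.RJetProjector (Rgt Rgt_apply Rgt_symm)
open Summit.QuantumFields.BalabanUV.Beta.D1BFx.KGhostLeg (Cgh Cgh_apply)
open Summit.QuantumFields.BalabanUV.Beta.D1BFx.TorusGhostWordArrays (lapU lapU_apply decays_lapU)
open Summit.QuantumFields.BalabanUV.Beta.D1BFx.KernelMassCalculus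
open Summit.QuantumFields.BalabanUV.Beta.D1BFx.KernelMassTotal
open Summit.QuantumFields.BalabanUV.Beta.D1BFx.GhostLegProfile (exists_Ggh_masses)
open Summit.QuantumFields.BalabanUV.Beta.D1BFx.GhostLegMasses (masses_Ggh masses_lapU_Ggh)
open Summit.QuantumFields.BalabanUV.Beta.D1BFx.ProjectorMasses (masses_Pgt masses_Rgt Rgt_eq_idK_sub)
open Summit.QuantumFields.BalabanUV.Beta.D1BFx.CoframeJetProjection (Cgh_eq_smul trK_Rgt)

variable {D : ℕ} {F : Type*} [Fintype F]

/-! ## §1 Generic helpers: tameness from masses, scalars through `comp`, `Zl` is antitone -/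

/-- [folklore] **MASSES GIVE TAMENESS**: `RowMass K 0 M → ColMass K 0 M′ → Tame K` (the row∕column profiles ARE summable majorants; sup `≤ M`). -/
theorem tame_of_masses {K : MKer D F} {M M' : ℝ} (hR : RowMass K 0 M) (hC : ColMass K 0 M') : Tame K := by
  refine ⟨fun x => ⟨rowFn K 0 x, (hR x).1, fun y => rowFn_nonneg K 0 x y, fun y a f => abs_le_rowFn_zero K x y a f⟩,
    fun z => ⟨fun y => rowFn K 0 y z, (hC z).1, fun y => rowFn_nonneg K 0 y z, fun y f b => abs_le_rowFn_zero K y z f b⟩,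
    ⟨M, fun x y a b => hR.abs_le le_rfl x y a b⟩⟩

/-- [folklore] `Zl D` is antitone in the rate: `0 < c ≤ c′ → Zl D c′ ≤ Zl D c`. -/
theorem Zl_antitone {c c' : ℝ} (hc : 0 < c) (hcc : c ≤ c') : Zl D c' ≤ Zl D c := by
  unfold Zl
  exact (summable_exp_neg_l1 (lt_of_lt_of_le hc hcc) D).tsum_le_tsum
    (fun x => Real.exp_le_exp.2 (by nlinarith [l1_nonneg x])) (summable_exp_neg_l1 hc D)

/-! ## §2 `lapU`, `Cgh` and `lapU∘Cgh` as kernels -/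

/-- [folklore] `lapU` is tame and symmetric. -/
theorem tame_lapU : Tame lapU ∧ trK lapU = lapU :=
⟨Spr.tame (A := lapU) ⟨_, 1, one_pos, decays_lapU⟩, by funext x y u v; unfold trK; rw [lapU_apply, lapU_apply, lapKer_symm]⟩

variable (n : ℕ) [NeZero n] {a : ℝ}

variable {θ : ℝ}

/-- [folklore] **THE MASSES OF `Cgh`**: from `RowMass∕ColMass (Ggh n a) θ g` and `RowMass∕ColMass (Rgt n a) θ r` (`θ ≥ 0`):
`RowMass∕ColMass (Cgh n a) θ (n⁴·(g·(r·g)))` — the TRUE `n⁴` (the road's `decays_Cgh` constant is `≍ n¹²` through two `Zl`). -/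
theorem masses_Cgh (hθ : 0 ≤ θ) {g r : ℝ} (hG : RowMass (Ggh n a) θ g ∧ ColMass (Ggh n a) θ g)
    (hR : RowMass (Rgt n a) θ r ∧ ColMass (Rgt n a) θ r) :
    RowMass (Cgh n a) θ ((n : ℝ) ^ 4 * (g * (r * g))) ∧ ColMass (Cgh n a) θ ((n : ℝ) ^ 4 * (g * (r * g))) := by
  have e : (n : ℝ) ^ 4 * (g * (r * g)) = |(n : ℝ) ^ 4| * (g * (r * g)) := by rw [abs_of_nonneg (by positivity)]
  rw [Cgh_eq_smul n a, e]
  exact ⟨(rowMass_comp hG.1 (rowMass_comp hR.1 hG.1 hθ) hθ).smul _, (colMass_comp hG.2 (colMass_comp hR.2 hG.2 hθ) hθ).smul _⟩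

/-- [folklore] **`lapU∘Cgh` REGROUPED**: `comp lapU (Cgh n a) = n⁴ • (lapU∘Ggh) ∘ (Rgt∘Ggh)` (associativity for tame kernels), given masses of `Ggh`, `Rgt`
at `θ = 0` (for tameness). -/
theorem lapU_comp_Cgh {g r : ℝ} (hG : RowMass (Ggh n a) 0 g ∧ ColMass (Ggh n a) 0 g) (hR : RowMass (Rgt n a) 0 r ∧ ColMass (Rgt n a) 0 r) :
    comp lapU (Cgh n a) = ((n : ℝ) ^ 4) • comp (comp lapU (Ggh n a)) (comp (Rgt n a) (Ggh n a)) := by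
  have hRG : Tame (comp (Rgt n a) (Ggh n a)) := tame_of_masses (rowMass_comp hR.1 hG.1 le_rfl) (colMass_comp hR.2 hG.2 le_rfl)
  rw [Cgh_eq_smul n a, StencilRealisation.comp_smul_right, comp_assoc_tame tame_lapU.1 (tame_of_masses hG.1 hG.2) hRG]

/-- [folklore] `Cgh∘lapU` is the transpose of `lapU∘Cgh` (all factors symmetric). -/
theorem trK_lapU_comp_Cgh (ha : 0 < a) {g r : ℝ} (hG : RowMass (Ggh n a) 0 g ∧ ColMass (Ggh n a) 0 g)
    (hR : RowMass (Rgt n a) 0 r ∧ ColMass (Rgt n a) 0 r) : trK (comp lapU (Cgh n a)) = comp (Cgh n a) lapU := by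
  have hG' := tame_of_masses hG.1 hG.2
  have hR' := tame_of_masses hR.1 hR.2
  have hCgh : trK (Cgh n a) = Cgh n a := by
    rw [Cgh_eq_smul n a]
    have : trK (((n : ℝ) ^ 4) • comp (Ggh n a) (comp (Rgt n a) (Ggh n a))) = ((n : ℝ) ^ 4) • trK (comp (Ggh n a) (comp (Rgt n a) (Ggh n a))) := rfl
    rw [this, trK_comp, trK_comp, trK_Ggh n a ha, trK_Rgt n a ha, ← comp_assoc_tame hG' hR' hG']
  rw [trK_comp, hCgh, tame_lapU.2]

/-- [folklore] **THE MASSES OF `lapU∘Cgh` AND `Cgh∘lapU`**: `n⁴·ℓ·(r·g)` with `ℓ = (n²)⁻¹(1 + a e^{4nθ} g)` the mass of `lapU∘Ggh` — i.e. `n²·(…)`,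
the TRUE power. -/
theorem masses_lapU_Cgh (ha : 0 < a) (hθ : 0 ≤ θ) {g r : ℝ} (hG : RowMass (Ggh n a) θ g ∧ ColMass (Ggh n a) θ g)
    (hR : RowMass (Rgt n a) θ r ∧ ColMass (Rgt n a) θ r) :
    (RowMass (comp lapU (Cgh n a)) θ ((n : ℝ) ^ 4 * ((((n : ℝ) ^ 2)⁻¹ * (1 + a * Real.exp (4 * n * θ) * g)) * (r * g))) ∧
      ColMass (comp lapU (Cgh n a)) θ ((n : ℝ) ^ 4 * ((((n : ℝ) ^ 2)⁻¹ * (1 + a * Real.exp (4 * n * θ) * g)) * (r * g)))) ∧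
    (RowMass (comp (Cgh n a) lapU) θ ((n : ℝ) ^ 4 * ((((n : ℝ) ^ 2)⁻¹ * (1 + a * Real.exp (4 * n * θ) * g)) * (r * g))) ∧
      ColMass (comp (Cgh n a) lapU) θ ((n : ℝ) ^ 4 * ((((n : ℝ) ^ 2)⁻¹ * (1 + a * Real.exp (4 * n * θ) * g)) * (r * g)))) := by
  have hG0 : RowMass (Ggh n a) 0 g ∧ ColMass (Ggh n a) 0 g := ⟨hG.1.mono hθ le_rfl, hG.2.mono hθ le_rfl⟩
  have hR0 : RowMass (Rgt n a) 0 r ∧ ColMass (Rgt n a) 0 r := ⟨hR.1.mono hθ le_rfl, hR.2.mono hθ le_rfl⟩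
  obtain ⟨hLr, hLc⟩ := masses_lapU_Ggh n ha hθ hG
  have e : (n : ℝ) ^ 4 * ((((n : ℝ) ^ 2)⁻¹ * (1 + a * Real.exp (4 * n * θ) * g)) * (r * g))
      = |(n : ℝ) ^ 4| * ((((n : ℝ) ^ 2)⁻¹ * (1 + a * Real.exp (4 * n * θ) * g)) * (r * g)) := by rw [abs_of_nonneg (by positivity)]
  have h1 : RowMass (comp lapU (Cgh n a)) θ ((n : ℝ) ^ 4 * ((((n : ℝ) ^ 2)⁻¹ * (1 + a * Real.exp (4 * n * θ) * g)) * (r * g))) ∧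
      ColMass (comp lapU (Cgh n a)) θ ((n : ℝ) ^ 4 * ((((n : ℝ) ^ 2)⁻¹ * (1 + a * Real.exp (4 * n * θ) * g)) * (r * g))) := by
    rw [lapU_comp_Cgh n hG0 hR0, e]
    exact ⟨(rowMass_comp hLr (rowMass_comp hR.1 hG.1 hθ) hθ).smul _, (colMass_comp hLc (colMass_comp hR.2 hG.2 hθ) hθ).smul _⟩
  refine ⟨h1, ?_, ?_⟩
  · rw [rowMass_iff_colMass_trK, ← trK_lapU_comp_Cgh n ha hG0 hR0, trK_trK]; exact h1.2
  · rw [colMass_iff_rowMass_trK, ← trK_lapU_comp_Cgh n ha hG0 hR0, trK_trK]; exact h1.1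

/-- [folklore] **`Ggh∘lapU` BY TRANSPOSITION**: `comp (Ggh n a) lapU = trK (comp lapU (Ggh n a))`, hence its θ-masses are those of `lapU∘Ggh` swapped. -/
theorem masses_Ggh_lapU (ha : 0 < a) {ℓ : ℝ} (hL : RowMass (comp lapU (Ggh n a)) θ ℓ ∧ ColMass (comp lapU (Ggh n a)) θ ℓ) :
    RowMass (comp (Ggh n a) lapU) θ ℓ ∧ ColMass (comp (Ggh n a) lapU) θ ℓ := by
  have e : comp (Ggh n a) lapU = trK (comp lapU (Ggh n a)) := by
    rw [trK_comp, trK_Ggh n a ha, tame_lapU.2]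
  rw [e, ← colMass_iff_rowMass_trK, ← rowMass_iff_colMass_trK]
  exact ⟨hL.2, hL.1⟩

/-- [folklore] **`lapU∘Cgh∘lapU` REGROUPED**: `comp (comp lapU (Cgh n a)) lapU = n⁴ • (lapU∘Ggh) ∘ (Rgt ∘ (Ggh∘lapU))` (associativity for tame kernels). -/
theorem lapU_comp_Cgh_comp_lapU {g r ℓ : ℝ} (hG : RowMass (Ggh n a) 0 g ∧ ColMass (Ggh n a) 0 g) (hR : RowMass (Rgt n a) 0 r ∧ ColMass (Rgt n a) 0 r)
    (hL : RowMass (comp lapU (Ggh n a)) 0 ℓ ∧ ColMass (comp lapU (Ggh n a)) 0 ℓ) :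
    comp (comp lapU (Cgh n a)) lapU = ((n : ℝ) ^ 4) • comp (comp lapU (Ggh n a)) (comp (Rgt n a) (comp (Ggh n a) lapU)) := by
  have hG' := tame_of_masses hG.1 hG.2
  have hR' := tame_of_masses hR.1 hR.2
  have hL' := tame_of_masses hL.1 hL.2
  have hRG : Tame (comp (Rgt n a) (Ggh n a)) := tame_of_masses (rowMass_comp hR.1 hG.1 le_rfl) (colMass_comp hR.2 hG.2 le_rfl)
  rw [lapU_comp_Cgh n hG hR, StencilRealisation.comp_smul_left, ← comp_assoc_tame hL' hRG tame_lapU.1, ← comp_assoc_tame hR' hG' tame_lapU.1]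

/-- [folklore] **THE MASSES OF `lapU∘Cgh∘lapU`**: `n⁴·(ℓ·(r·ℓ))` with `ℓ = (n²)⁻¹(1 + a e^{4nθ} g)` — i.e. `n⁰·const`, the TRUE power of the doubly
differentiated leg (both `(−Δ)` bind to a `Ggh`). -/
theorem masses_lapU_Cgh_lapU (ha : 0 < a) (hθ : 0 ≤ θ) {g r : ℝ} (hG : RowMass (Ggh n a) θ g ∧ ColMass (Ggh n a) θ g)
    (hR : RowMass (Rgt n a) θ r ∧ ColMass (Rgt n a) θ r) :
    RowMass (comp (comp lapU (Cgh n a)) lapU) θ ((n : ℝ) ^ 4 * ((((n : ℝ) ^ 2)⁻¹ * (1 + a * Real.exp (4 * n * θ) * g))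
        * (r * (((n : ℝ) ^ 2)⁻¹ * (1 + a * Real.exp (4 * n * θ) * g))))) ∧
      ColMass (comp (comp lapU (Cgh n a)) lapU) θ ((n : ℝ) ^ 4 * ((((n : ℝ) ^ 2)⁻¹ * (1 + a * Real.exp (4 * n * θ) * g))
        * (r * (((n : ℝ) ^ 2)⁻¹ * (1 + a * Real.exp (4 * n * θ) * g))))) := by
  have hG0 : RowMass (Ggh n a) 0 g ∧ ColMass (Ggh n a) 0 g := ⟨hG.1.mono hθ le_rfl, hG.2.mono hθ le_rfl⟩
  have hR0 : RowMass (Rgt n a) 0 r ∧ ColMass (Rgt n a) 0 r := ⟨hR.1.mono hθ le_rfl, hR.2.mono hθ le_rfl⟩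
  have hLθ := masses_lapU_Ggh n ha hθ hG
  have hL0 : RowMass (comp lapU (Ggh n a)) 0 _ ∧ ColMass (comp lapU (Ggh n a)) 0 _ := ⟨hLθ.1.mono hθ le_rfl, hLθ.2.mono hθ le_rfl⟩
  have hT := masses_Ggh_lapU n ha hLθ
  have e : (n : ℝ) ^ 4 * ((((n : ℝ) ^ 2)⁻¹ * (1 + a * Real.exp (4 * n * θ) * g)) * (r * (((n : ℝ) ^ 2)⁻¹ * (1 + a * Real.exp (4 * n * θ) * g))))
      = |(n : ℝ) ^ 4| * ((((n : ℝ) ^ 2)⁻¹ * (1 + a * Real.exp (4 * n * θ) * g)) * (r * (((n : ℝ) ^ 2)⁻¹ * (1 + a * Real.exp (4 * n * θ) * g)))) := by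
    rw [abs_of_nonneg (by positivity)]
  rw [lapU_comp_Cgh_comp_lapU n hG0 hR0 hL0, e]
  exact ⟨(rowMass_comp hLθ.1 (rowMass_comp hR.1 hT.1 hθ) hθ).smul _, (colMass_comp hLθ.2 (colMass_comp hR.2 hT.2 hθ) hθ).smul _⟩

/-! ## §3 The master letter on the scales `n = L^k` -/

/-- [folklore] **«LEG-MASS» — ALL THE ROAD's LEGS, n-FREE, ON THE SCALES `n = L^k`**: for `L ≥ 2`, `a > 0` there are `θ₀ > 0` and `g, π ≥ 0` (functions of
`L, a` only) such that for every `k ≥ 1`, `n = L^k` and every weight `0 ≤ θ ≤ θ₀∕n`: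
`RowMass∕ColMass (Ggh n a) θ g`, `RowMass∕ColMass (comp lapU (Ggh n a)) θ ((n²)⁻¹·(1 + a·e^{4θ₀}·g))`, `RowMass∕ColMass (Pgt n a) θ π`,
`RowMass∕ColMass (Rgt n a) θ (1 + π)`, `RowMass∕ColMass (Cgh n a) θ (n⁴·(g·((1+π)·g)))`, and for BOTH `comp lapU (Cgh n a)` and `comp (Cgh n a) lapU`:
`RowMass∕ColMass θ (n⁴·((n²)⁻¹·(1 + a·e^{4θ₀}·g))·((1+π)·g))` (`= n²·const`), and for `comp (comp lapU (Cgh n a)) lapU`: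
`RowMass∕ColMass θ (n⁴·ℓ₀·((1+π)·ℓ₀))`, `ℓ₀ = (n²)⁻¹·(1 + a·e^{4θ₀}·g)` (`= n⁰·const`).  Inputs: β2 `exists_Ggh_masses` (lit-balaban's profile of `G_k(0)`),
γ1 (dictionary), γ2 (projector on the sublattice). -/
theorem exists_leg_masses {L : ℕ} (hL : 2 ≤ L) (ha : 0 < a) :
    ∃ θ₀ g π : ℝ, 0 < θ₀ ∧ 0 ≤ g ∧ 0 ≤ π ∧ ∀ (k : ℕ), 1 ≤ k → ∀ (n : ℕ) [NeZero n], n = L ^ k → ∀ θ : ℝ, 0 ≤ θ → θ ≤ θ₀ / n →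
      (RowMass (Ggh n a) θ g ∧ ColMass (Ggh n a) θ g) ∧
      (RowMass (comp lapU (Ggh n a)) θ (((n : ℝ) ^ 2)⁻¹ * (1 + a * Real.exp (4 * θ₀) * g)) ∧
        ColMass (comp lapU (Ggh n a)) θ (((n : ℝ) ^ 2)⁻¹ * (1 + a * Real.exp (4 * θ₀) * g))) ∧
      (RowMass (Pgt n a) θ π ∧ ColMass (Pgt n a) θ π) ∧
      (RowMass (Rgt n a) θ (1 + π) ∧ ColMass (Rgt n a) θ (1 + π)) ∧
      (RowMass (Cgh n a) θ ((n : ℝ) ^ 4 * (g * ((1 + π) * g))) ∧ ColMass (Cgh n a) θ ((n : ℝ) ^ 4 * (g * ((1 + π) * g)))) ∧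
      (RowMass (comp lapU (Cgh n a)) θ ((n : ℝ) ^ 4 * ((((n : ℝ) ^ 2)⁻¹ * (1 + a * Real.exp (4 * θ₀) * g)) * ((1 + π) * g))) ∧
        ColMass (comp lapU (Cgh n a)) θ ((n : ℝ) ^ 4 * ((((n : ℝ) ^ 2)⁻¹ * (1 + a * Real.exp (4 * θ₀) * g)) * ((1 + π) * g)))) ∧
      (RowMass (comp (Cgh n a) lapU) θ ((n : ℝ) ^ 4 * ((((n : ℝ) ^ 2)⁻¹ * (1 + a * Real.exp (4 * θ₀) * g)) * ((1 + π) * g))) ∧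
        ColMass (comp (Cgh n a) lapU) θ ((n : ℝ) ^ 4 * ((((n : ℝ) ^ 2)⁻¹ * (1 + a * Real.exp (4 * θ₀) * g)) * ((1 + π) * g)))) ∧
      (RowMass (comp (comp lapU (Cgh n a)) lapU) θ ((n : ℝ) ^ 4 * ((((n : ℝ) ^ 2)⁻¹ * (1 + a * Real.exp (4 * θ₀) * g))
          * ((1 + π) * (((n : ℝ) ^ 2)⁻¹ * (1 + a * Real.exp (4 * θ₀) * g))))) ∧
        ColMass (comp (comp lapU (Cgh n a)) lapU) θ ((n : ℝ) ^ 4 * ((((n : ℝ) ^ 2)⁻¹ * (1 + a * Real.exp (4 * θ₀) * g))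
          * ((1 + π) * (((n : ℝ) ^ 2)⁻¹ * (1 + a * Real.exp (4 * θ₀) * g)))))) := by
  obtain ⟨δ, g₀, g₁, hδ, hg₀, hg₁, hM⟩ := exists_Ggh_masses hL ha
  have hδC := deltaC_pos 4 ha
  have hcC := (cC_pos 4 ha).le
  set θ₀ : ℝ := min (δ / 8) (deltaC 4 a / 8) with hθ₀
  have hθ₀pos : 0 < θ₀ := lt_min (by positivity) (by positivity)
  have hθ₀δ : θ₀ ≤ δ / 8 := min_le_left _ _
  have hθ₀C : θ₀ ≤ deltaC 4 a / 8 := min_le_right _ _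
  set π : ℝ := Real.exp (8 * θ₀) * g₀ ^ 2 * (cC 4 a * Zl 4 (deltaC 4 a / 8)) with hπ
  have hZ8 : 0 < Zl 4 (deltaC 4 a / 8) := Zl_pos (by positivity)
  have hπ0 : 0 ≤ π := by positivity
  refine ⟨θ₀, g₀, π, hθ₀pos, hg₀, hπ0, fun k hk n _ hn θ hθ0 hθ => ?_⟩
  have hn1 : (1 : ℝ) ≤ n := by exact_mod_cast NeZero.one_le
  have hn0 : (0 : ℝ) < n := by positivity
  have hnθ : (n : ℝ) * θ ≤ θ₀ := by rwa [le_div_iff₀ hn0, mul_comm] at hθ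
  have hθδ : θ ≤ δ / (8 * n) := by
    rw [le_div_iff₀ (by positivity)]; nlinarith
  have hθC : (n : ℝ) * θ < deltaC 4 a / 4 := by linarith
  -- `Ggh`
  have hG : RowMass (Ggh n a) θ g₀ ∧ ColMass (Ggh n a) θ g₀ :=
    masses_Ggh n ha fun x => (hM k hk n hn θ hθδ x () ()).1
  -- `lapU ∘ Ggh` (weaken `e^{4nθ} ≤ e^{4θ₀}`)
  have he4 : Real.exp (4 * n * θ) ≤ Real.exp (4 * θ₀) := Real.exp_le_exp.2 (by nlinarith)
  have hℓ : ((n : ℝ) ^ 2)⁻¹ * (1 + a * Real.exp (4 * n * θ) * g₀) ≤ ((n : ℝ) ^ 2)⁻¹ * (1 + a * Real.exp (4 * θ₀) * g₀) :=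
    mul_le_mul_of_nonneg_left (by nlinarith [mul_le_mul_of_nonneg_left he4 ha.le]) (by positivity)
  obtain ⟨hLr, hLc⟩ := masses_lapU_Ggh n ha hθ0 hG
  -- `Pgt` (weaken `e^{8nθ} ≤ e^{8θ₀}`, `Zl (δC∕4 − nθ) ≤ Zl (δC∕8)`)
  obtain ⟨hPr, hPc⟩ := masses_Pgt (n := n) ha hθ0 hθC hG
  have hπle : Real.exp (8 * n * θ) * g₀ ^ 2 * (cC 4 a * Zl 4 (deltaC 4 a / 4 - n * θ)) ≤ π := by
    have h1 : Real.exp (8 * n * θ) ≤ Real.exp (8 * θ₀) := Real.exp_le_exp.2 (by nlinarith)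
    have h2 : Zl 4 (deltaC 4 a / 4 - n * θ) ≤ Zl 4 (deltaC 4 a / 8) := Zl_antitone (by positivity) (by linarith)
    rw [hπ]
    exact mul_le_mul (mul_le_mul_of_nonneg_right h1 (by positivity)) (mul_le_mul_of_nonneg_left h2 hcC)
      (mul_nonneg hcC (Zl_pos (by linarith)).le) (by positivity)
  have hP : RowMass (Pgt n a) θ π ∧ ColMass (Pgt n a) θ π := ⟨hPr.mono le_rfl hπle, hPc.mono le_rfl hπle⟩
  have hR := masses_Rgt (n := n) hP
  have hC := masses_Cgh n hθ0 hG hR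
  obtain ⟨hX, hXt⟩ := masses_lapU_Cgh n ha hθ0 hG hR
  have hbig : (n : ℝ) ^ 4 * ((((n : ℝ) ^ 2)⁻¹ * (1 + a * Real.exp (4 * n * θ) * g₀)) * ((1 + π) * g₀))
      ≤ (n : ℝ) ^ 4 * ((((n : ℝ) ^ 2)⁻¹ * (1 + a * Real.exp (4 * θ₀) * g₀)) * ((1 + π) * g₀)) :=
    mul_le_mul_of_nonneg_left (mul_le_mul_of_nonneg_right hℓ (by positivity)) (by positivity)
  have hY := masses_lapU_Cgh_lapU n ha hθ0 hG hR
  have hℓ0 : 0 ≤ ((n : ℝ) ^ 2)⁻¹ * (1 + a * Real.exp (4 * n * θ) * g₀) := by positivity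
  have hbig2 : (n : ℝ) ^ 4 * ((((n : ℝ) ^ 2)⁻¹ * (1 + a * Real.exp (4 * n * θ) * g₀))
        * ((1 + π) * (((n : ℝ) ^ 2)⁻¹ * (1 + a * Real.exp (4 * n * θ) * g₀))))
      ≤ (n : ℝ) ^ 4 * ((((n : ℝ) ^ 2)⁻¹ * (1 + a * Real.exp (4 * θ₀) * g₀))
        * ((1 + π) * (((n : ℝ) ^ 2)⁻¹ * (1 + a * Real.exp (4 * θ₀) * g₀)))) :=
    mul_le_mul_of_nonneg_left (mul_le_mul hℓ (mul_le_mul_of_nonneg_left hℓ (by positivity)) (by positivity) (hℓ0.trans hℓ))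
      (by positivity)
  exact ⟨hG, ⟨hLr.mono le_rfl hℓ, hLc.mono le_rfl hℓ⟩, hP, hR, hC, ⟨hX.1.mono le_rfl hbig, hX.2.mono le_rfl hbig⟩,
    ⟨hXt.1.mono le_rfl hbig, hXt.2.mono le_rfl hbig⟩, ⟨hY.1.mono le_rfl hbig2, hY.2.mono le_rfl hbig2⟩⟩

end Summit.QuantumFields.BalabanUV.Beta.D1BFx.CompositeLegMasses

end
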